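import Summits.MatrixMultiplication.MatrixMultiplication.Theses.ThinBlockAlpha
import Summits.MatrixMultiplication.MatrixMultiplication.Theorems.ThinPackings.Negative.TriageRuledGraphPatternedArc

/-!
# Line `label-weighted-stpp-debordering` — checked skeleton for crux `ThinPackings` (lead's reshape v2)
(stmt-MatrixMultiplication-10595, route `ThinBlockAlpha`)

Planner `planner-cruxplan-stmt-MatrixMultiplication-10595-label-weighted-stpp--0` (crux-plan, round 1,
2026-08-16).  Idea card `Cruxes/ThinPackings/Ideas/label-weighted-stpp-debordering.md` (ideator 3), sharpened
by TRIAGE-r1-1 §D, TRIAGE-r1-2 (Part C of `Theorems/ThinPackings/Negative/TriageRuledGraphPatternedArc.lean`: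
popular-class collapse `isSTPP_comp_of_const_potentials`, repaired sanity lemma
`isLabelWeightedSTPP_of_isSTPP`) and TRIAGE-r1-3 (consistent grading rule for multi-radius sphere frames;
"plan sphere frames with anti-correlated radii + Debordering as ONE line").  Line card:
`Cruxes/ThinPackings/Lines/label-weighted-stpp-debordering.md`.

## The line

The crux `ThinPackings` asks, for every shape exponent `a < 1` and slack `η > 0`, for a two-leg-tight family of
thin STPP blocks `⟨N, M, N⟩`, `M ≥ N^a`, in some finite abelian group.  The line replaces `IsSTPP` by the
LABEL-WEIGHTED STPP (`IsLabelWeightedSTPP`, a monomial degeneration of the group tensor with block-constant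
potentials `κ, μ`): a cross relation with labels `(i, j, k)` not all equal is ADMISSIBLE when its weight
`(κ i − κ k) + (μ j − μ k)` is `≥ 1`.  Two provable-now TOOLS carry such a family to the crux:

* `stub_deborderingPower` (de-bordering, the STPP mirror image of BCCGNSU 2017 Lemma 3.4): in `Hⁿ` the product
  blocks whose label words have a fixed pair of weight sums form a genuine `IsSTPP` family of
  `≥ Lⁿ/(2nR+1)²` blocks `⟨Nⁿ, Mⁿ, Nⁿ⟩`; the loss `(2nR+1)²` is `N^{o(n)}`, so the slack `η` survives
  (`debordering : DeborderingPower → Debordering`, PROVED below; `Debordering := WeightedThinPackings → ThinPackings` is the card's first lemma);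
* `stub_boxFreiman` (Freiman box transfer): a label-weighted family of integer vectors in the box `[-b, b]^D`
  stays label-weighted, with the same potentials and cardinalities, after reduction modulo any `m > 6b`
  (relations have six terms), so designs may be built in `ℤ^D` with Euclidean geometry available.

The CONSTRUCTION side is the regime the triage isolated as the only one where weights are not bookkeeping
(potentials with many levels, blocks with different difference sets): MULTI-RADIUS ORTHOGONAL FRAMES.  Block `i`
carries an integer grade `d i`; its three legs are pointwise orthogonal and lie on spheres of squared radii
`xA + α·d i`, `xB − β·d i`, `xC + γ·d i` with admissible slopes `0 ≤ α, γ < β`, `α + γ ≥ 1`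
(TRIAGE-r1-3's anti-correlation rule; `(α, β, γ) = (1, 2, 1)` is the model case).  Pythagoras then discharges
the TPP of every block and turns EVERY two-label cross relation into a strict increase of the relevant squared
radius, which the symmetric potential `κ = μ = −d` pays for (`stub_gradedFrames`, provable now: the weighted
family condition is EQUIVALENT to the three packings plus the all-distinct clause restricted to the NON-CONVEX
triples `2·d k ≤ d i + d j`).  Single-radius families (`d` constant) are the sibling card
`three-sphere-frame-designs` (`ThreeSpherePairCollapse`), where weights are void; with several radii the tiles
spread over all spheres of the box (removing the single-layer loss of TRIAGE-r1-3 doubt (2)), tiles and `E/F`-sets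
of different grades are disjoint for free, zones of grade `d` may enter every tile of higher grade, and half of
the distinct-label clauses disappear.  What is left is the open design statement `stub_multiRadiusFrames`
(hardest stub): such frame systems exist in boxes `[-b, b]^D` with `(6b+1)^D ≤ L·N^{2+η}`.

Composition (closed term, no hypotheses; sorries only in the four `stub_*`):
`ThinPackings_of = debordering stub_deborderingPower
   (weightedThinPackings_of_frames stub_boxFreiman stub_gradedFrames stub_multiRadiusFrames)`.

## Disproof.lean used (cdisprove gen 1, read 2026-08-16T02:15Z) and landed Negative lemmas

No `_false_without_` theorem and no §4 Target is registered yet.  Honoured: §3b `not_thinPackingsSingleBlock`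
(`stub_multiRadiusFrames` asks for `L` blocks, and its count forces `L ≥ N^{a−η}` exactly as `rpow_sub_le_L`);
`not_thinPackingsBoundedN` / `M_le` (the box side `b`, hence `N`, must grow as `η → 0`);
`not_thinPackingsBoundedExponent` (hosts `(ℤ/(6b+1))^{D·n}` have exponent `6b+1 → ∞`; B7 of
`Ideator3NegativeNotesG2.md` quantifies how fast); `not_thinPackingsExact` (slack is built in); §1
`packing_three`/`thin_packing_bound` constrain only the de-bordered `IsSTPP` family, which meets them, and do
NOT transfer to weighted families (card, confirmed by TRIAGE-r1-1); §5 `cThesis_of_thinPackings`: the line is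
`≥ X_C`-hard, conceded.  Negatives index (4 refuted statements: frames/lines over `F_q`, separable CW designs,
level-two Cohn–Umans): none is restated — the frames here are Euclidean (`ℤ^D`), not `F_q`-subspace frames, and
`BoundedRankFrameBarrier.frame_packing_defect` concerns punctured `F_q`-subspaces.

`IsLabelWeightedSTPP` is IMPORTED from the landed `Theorems/ThinPackings/Negative/TriageRuledGraphPatternedArc.lean`
(namespace `…Negative.Triage2`; lead's reshape v2 — the planner's v1 carried a verbatim copy because the module was
unbuilt on the farm at planning time), so `isSTPP_comp_of_const_potentials`, `isLabelWeightedSTPP_of_isSTPP` apply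
literally.
-/

set_option linter.dupNamespace false

namespace Summit.MatrixMultiplication.MatrixMultiplication.Cruxes.ThinPackings.LabelWeightedStppDebordering

open Finset Filter
open Literature.Computability.AlgebraicComplexity (IsSTPP)
open Summit.MatrixMultiplication.MatrixMultiplication.Theses.ThinBlockAlpha (ThinPackings)
open Summit.MatrixMultiplication.MatrixMultiplication.Theorems.ThinPackings.Negative.Triage2 (IsLabelWeightedSTPP)

/-! ## Objects -/

/-! `IsLabelWeightedSTPP A B C κ μ` is the LANDED tree predicate
`Summit.…Theorems.ThinPackings.Negative.Triage2.IsLabelWeightedSTPP` (p75378; clauses (1)–(3) the three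
packings, (4) the TPP of each block — all HARD — and (5) a cross relation with labels `(i, j, k)` not all equal is
admissible iff its weight `(κ i − κ k) + (μ j − μ k) ≥ 1`).  Lead's reshape v2 (2026-08-16): the planner's verbatim
local copy is dropped in favour of the tree declaration, `ip` is Mathlib's `dotProduct` (`⬝ᵥ`), and the four stubs are
stated in fully explicit tree vocabulary so that the registered signatures are exactly the statements the stub files
under `Theorems/` prove. -/

/-- **Weighted thin packings** — the transferred form `C⁺` of the crux: `ThinPackings` with `IsSTPP` relaxed to
`IsLabelWeightedSTPP`, potentials bounded by `R` (any `R`; the bound is only recorded for the de-bordering count).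
`C⁺ → ThinPackings` is `Debordering`, proved as `debordering` from `stub_deborderingPower`; conversely every crux
witness is a `C⁺` witness with `κ = μ = 0` (landed `isLabelWeightedSTPP_of_isSTPP`, legs nonempty), so `C⁺` is a
reformulation with a strictly larger witness space, not a strengthening. -/
def WeightedThinPackings : Prop :=
  ∀ a : ℝ, 0 ≤ a → a < 1 → ∀ η : ℝ, 0 < η → ∃ (H : Type) (_ : AddCommGroup H) (_ : Fintype H)
    (L N M R : ℕ) (A B C : Fin L → Finset H) (κ μ : Fin L → ℤ), IsLabelWeightedSTPP A B C κ μ ∧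
    (∀ i, (A i).card = N ∧ (B i).card = M ∧ (C i).card = N) ∧ 2 ≤ N ∧ (N : ℝ) ^ a ≤ M ∧
    (∀ i, |κ i| ≤ R ∧ |μ i| ≤ R) ∧ (Fintype.card H : ℝ) ≤ L * (N : ℝ) ^ (2 + η)

/-- **De-bordering** (the card's first lemma, by name): `C⁺ → ThinPackings`.  Proved below from the finite
core `DeborderingPower` (`debordering`); stated as a named `Prop` so that the skeleton audit sees exactly one
theorem concluding the crux by name (`ThinPackings_of`). -/
def Debordering : Prop := WeightedThinPackings → ThinPackings

/-- Coordinatewise reduction `ℤ^D → (ℤ/m)^D` (the Freiman box embedding). -/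
def boxCast (D m : ℕ) (v : Fin D → ℤ) : Fin D → ZMod m := fun t => (v t : ZMod m)

/-- All legs of all blocks lie in the box `[-b, b]^D`. -/
def InBox {D L : ℕ} (A B C : Fin L → Finset (Fin D → ℤ)) (b : ℕ) : Prop :=
  ∀ i, (∀ v ∈ A i, ∀ t, |v t| ≤ b) ∧ (∀ v ∈ B i, ∀ t, |v t| ≤ b) ∧ (∀ v ∈ C i, ∀ t, |v t| ≤ b)

/-- **Orthogonal frame family**: inside every block the three legs are pointwise orthogonal. -/
def IsFrameFamily {D L : ℕ} (A B C : Fin L → Finset (Fin D → ℤ)) : Prop :=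
  (∀ i, ∀ x ∈ A i, ∀ y ∈ B i, x ⬝ᵥ y = 0) ∧ (∀ i, ∀ x ∈ A i, ∀ z ∈ C i, x ⬝ᵥ z = 0) ∧
  (∀ i, ∀ y ∈ B i, ∀ z ∈ C i, y ⬝ᵥ z = 0)

/-- **Graded spheres**: block `i` has grade `d i`, and its legs lie on the spheres of squared radii
`xA + α·d i`, `xB − β·d i`, `xC + γ·d i` (affine in the grade; the middle radius is ANTI-correlated). -/
def OnGradedSpheres {D L : ℕ} (A B C : Fin L → Finset (Fin D → ℤ)) (d : Fin L → ℤ)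
    (xA xB xC α β γ : ℤ) : Prop :=
  (∀ i, ∀ x ∈ A i, x ⬝ᵥ x = xA + α * d i) ∧ (∀ i, ∀ y ∈ B i, y ⬝ᵥ y = xB - β * d i) ∧
  (∀ i, ∀ z ∈ C i, z ⬝ᵥ z = xC + γ * d i)

/-- Admissible slopes (TRIAGE-r1-3's consistency rule): the tile radius `xA + xC + (α+γ)d` strictly increases
with the grade while both mixed radii `xA + xB + (α−β)d`, `xB + xC + (γ−β)d` strictly decrease. -/
def AdmissibleSlopes (α β γ : ℤ) : Prop := 0 ≤ α ∧ 0 ≤ γ ∧ 1 ≤ α + γ ∧ α < β ∧ γ < β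

/-- **Residual clauses** of a graded family: the three packings (tiles `C − A`, `B − A`, `B − C` pairwise
disjoint across blocks with unique representation — automatic across DIFFERENT grades on graded spheres) and the
all-distinct-label clause restricted to the NON-CONVEX triples `2·d k ≤ d i + d j` (the convex ones are paid for
by the weight `2·d k − d i − d j ≥ 1`). -/
def ResidualClauses {H : Type*} [AddCommGroup H] {L : ℕ} (A B C : Fin L → Finset H) (d : Fin L → ℤ) :
    Prop :=
  (∀ i k, ∀ a ∈ A i, ∀ c ∈ C i, ∀ a' ∈ A k, ∀ c' ∈ C k, c - a = c' - a' → i = k ∧ a = a' ∧ c = c') ∧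
  (∀ i k, ∀ a ∈ A i, ∀ b ∈ B i, ∀ a' ∈ A k, ∀ b' ∈ B k, b - a = b' - a' → i = k ∧ a = a' ∧ b = b') ∧
  (∀ i k, ∀ b ∈ B i, ∀ c ∈ C i, ∀ b' ∈ B k, ∀ c' ∈ C k, b - c = b' - c' → i = k ∧ b = b' ∧ c = c') ∧
  (∀ i j k : Fin L, i ≠ j → j ≠ k → i ≠ k → 2 * d k ≤ d i + d j →
      ∀ s ∈ A k, ∀ s' ∈ A i, ∀ t ∈ B i, ∀ t' ∈ B j, ∀ u ∈ C j, ∀ u' ∈ C k,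
        (s' - s) + (t' - t) + (u' - u) ≠ 0)

/-! ## Stub statements (named, so that the registered signatures stay short) -/

/-- Statement of `stub_deborderingPower` — DE-BORDERING, finite core (card `DeborderingPower`; TRIAGE-r1-1 §D,
r1-2, r1-3: verified by hand, degenerate cases `n = 0`, `L = 0`, `R = 0` included).  For a label-weighted family
of `L` blocks `⟨N, M, N⟩` with potentials in `[-R, R]` and every `n`: the product blocks `A_w = ∏ₜ A (w t)`
(`w : Fin n → Fin L`) of ONE class `(Σₜ κ (w t), Σₜ μ (w t)) = (p, q)` of maximal size form an `IsSTPP` family in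
`Fin n → H`; there are `≤ (2nR+1)²` classes.  Proof: a relation among three words of the class holds
coordinatewise; a coordinate with equal labels is trivial by clause (4) (weight `0`), any other has weight `≥ 1`
by clause (5); the total weight is `(p − p) + (q − q) = 0`, so every coordinate is diagonal. [M, provable now] -/
def DeborderingPower : Prop :=
  ∀ (H : Type) [AddCommGroup H] (L N M R : ℕ) (A B C : Fin L → Finset H) (κ μ : Fin L → ℤ),
    IsLabelWeightedSTPP A B C κ μ → (∀ i, (A i).card = N ∧ (B i).card = M ∧ (C i).card = N) →
    (∀ i, |κ i| ≤ R ∧ |μ i| ≤ R) →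
    ∀ n : ℕ, ∃ (L' : ℕ) (A' B' C' : Fin L' → Finset (Fin n → H)),
      IsSTPP A' B' C' ∧ (∀ i, (A' i).card = N ^ n ∧ (B' i).card = M ^ n ∧ (C' i).card = N ^ n) ∧
      L ^ n ≤ L' * (2 * n * R + 1) ^ 2

/-- Statement of `stub_boxFreiman` — FREIMAN BOX TRANSFER: reduction modulo `m > 6b` of a label-weighted family
supported in `[-b, b]^D` is label-weighted with the same potentials and the same cardinalities (every clause is a
relation with at most six terms of sup-norm `≤ b`, so it lifts from `(ℤ/m)^D` to `ℤ^D`; `boxCast` is injective on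
the box). [S/M, provable now] -/
def BoxFreimanTransfer : Prop :=
  ∀ (D L b m : ℕ) (A B C : Fin L → Finset (Fin D → ℤ)) (κ μ : Fin L → ℤ),
    6 * b < m → InBox A B C b → IsLabelWeightedSTPP A B C κ μ →
    IsLabelWeightedSTPP (fun i => (A i).image (boxCast D m)) (fun i => (B i).image (boxCast D m))
        (fun i => (C i).image (boxCast D m)) κ μ ∧
    (∀ i, ((A i).image (boxCast D m)).card = (A i).card ∧
      ((B i).image (boxCast D m)).card = (B i).card ∧ ((C i).image (boxCast D m)).card = (C i).card)

/-- Statement of `stub_gradedFrames` — GRADED FRAMES ARE WEIGHTED (the bridge; multi-radius generalisation of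
`Ideator3Sketch.ThreeSpherePairCollapse` with TRIAGE-r1-3's consistent rule, potentials `κ = μ = −d`):
for an orthogonal frame family on graded spheres with admissible slopes, `IsLabelWeightedSTPP A B C (−d) (−d)`
is EQUIVALENT to `ResidualClauses A B C d`.  `→`: clauses (1)–(3) are the packings, clause (5) with weight
`2·d k − d i − d j ≤ 0` forbids the non-convex distinct relations.  `←`: TPP by Pythagoras (the three summands
are pairwise orthogonal); pattern `(i,i,k)`: `‖s − u'‖² = ‖s' − u‖² + ‖t' − t‖²` gives
`(α+γ)(d k − d i) = ‖t' − t‖²`, so either `t = t'` (a tile collision, excluded by packing (1) of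
`ResidualClauses`) or `d k ≥ d i + 1` and the weight `2(d k − d i)` is `≥ 2`; patterns `(i,j,j)`, `(i,j,i)`
likewise with `(α−β)(d i − d j) = ‖u − u'‖²`, `(γ−β)(d j − d i) = ‖s − s'‖²`; all-distinct: weight `≥ 1` or
excluded. Uses only `v ⬝ᵥ v ≥ 1` for `v ≠ 0` in `ℤ^D` (`dotProduct_self_eq_zero`, integrality). [M, provable now] -/
def GradedFramesWeighted : Prop :=
  ∀ (D L : ℕ) (A B C : Fin L → Finset (Fin D → ℤ)) (d : Fin L → ℤ) (xA xB xC α β γ : ℤ),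
    AdmissibleSlopes α β γ → IsFrameFamily A B C → OnGradedSpheres A B C d xA xB xC α β γ →
    (IsLabelWeightedSTPP A B C (fun i => -d i) (fun i => -d i) ↔ ResidualClauses A B C d)

/-- Statement of `stub_multiRadiusFrames` — THE CONSTRUCTION (open; the hardest stub): for every `a < 1`,
`η > 0` there are an orthogonal frame family on graded spheres with admissible slopes in a box `[-b, b]^D`,
blocks `⟨N, M, N⟩` with `N ≥ 2`, `M ≥ N^a`, grades in `[-R, R]`, satisfying the residual clauses, and
two-leg tight for the host `(ℤ/(6b+1))^D`: `(6b+1)^D ≤ L·N^{2+η}`.  Constant grade `d` = the sibling card's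
single-radius designs (so this is WEAKER than `three-sphere-frame-designs` K1+K2 in boxes); the informative
regime is bounded `D = D(a, η)`, `b → ∞`, `≈ b²` grades with `≈ L/b²` blocks each (TRIAGE-r1-2: weights have
content only with `N^{Ω(1)}` potential levels; here `b² ≥ N^{2/D}/4`), where single-radius families are capped at
slack `≥ b²` by the one-layer count and multi-radius ones are not.  Frames must be NON-coordinate: sign-coherent
(coordinate-disjoint) realisations discharge the distinct clause almost completely but their tiles vanish on the
block's `B`-support, which costs slack `≥ M`, i.e. `η ≥ a` (line card, "dead sub-ansatz"). [XL, open design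
problem] -/
def MultiRadiusFrameDesigns : Prop :=
  ∀ a : ℝ, 0 ≤ a → a < 1 → ∀ η : ℝ, 0 < η →
    ∃ (D L N M b R : ℕ) (A B C : Fin L → Finset (Fin D → ℤ)) (d : Fin L → ℤ) (xA xB xC α β γ : ℤ),
      AdmissibleSlopes α β γ ∧ IsFrameFamily A B C ∧ OnGradedSpheres A B C d xA xB xC α β γ ∧
      ResidualClauses A B C d ∧
      (∀ i, (A i).card = N ∧ (B i).card = M ∧ (C i).card = N) ∧ 2 ≤ N ∧ (N : ℝ) ^ a ≤ M ∧
      InBox A B C b ∧ (∀ i, |d i| ≤ R) ∧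
      (((6 * b + 1 : ℕ) : ℝ)) ^ D ≤ L * (N : ℝ) ^ (2 + η)

/-! ## Registered stubs (the only `sorry`s of the line)

Each stub is stated in EXPLICIT tree vocabulary (`IsSTPP`, `Triage2.IsLabelWeightedSTPP`, `dotProduct`, `Finset`,
`ZMod`), definitionally equal to the named `Prop` above it (`stub_x : X` is checked below by `example`), so that a
stub file `Theorems/ThinBlockAlphaThinPackingsStub<Name>.lean` proves the registered signature verbatim. -/

/-- **stub_deborderingPower** — de-bordering, finite core (`= DeborderingPower`). [M, provable now; TOOL] -/
theorem stub_deborderingPower :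
    ∀ (H : Type) [AddCommGroup H] (L N M R : ℕ) (A B C : Fin L → Finset H) (κ μ : Fin L → ℤ),
      IsLabelWeightedSTPP A B C κ μ → (∀ i, (A i).card = N ∧ (B i).card = M ∧ (C i).card = N) →
      (∀ i, |κ i| ≤ R ∧ |μ i| ≤ R) →
      ∀ n : ℕ, ∃ (L' : ℕ) (A' B' C' : Fin L' → Finset (Fin n → H)),
        IsSTPP A' B' C' ∧ (∀ i, (A' i).card = N ^ n ∧ (B' i).card = M ^ n ∧ (C' i).card = N ^ n) ∧
        L ^ n ≤ L' * (2 * n * R + 1) ^ 2 := by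
  sorry

/-- **stub_boxFreiman** — Freiman box transfer of label-weighted families (`= BoxFreimanTransfer`).
[S/M, provable now; TOOL] -/
theorem stub_boxFreiman :
    ∀ (D L b m : ℕ) (A B C : Fin L → Finset (Fin D → ℤ)) (κ μ : Fin L → ℤ),
      6 * b < m →
      (∀ i, (∀ v ∈ A i, ∀ t, |v t| ≤ (b : ℤ)) ∧ (∀ v ∈ B i, ∀ t, |v t| ≤ (b : ℤ)) ∧
        (∀ v ∈ C i, ∀ t, |v t| ≤ (b : ℤ))) →
      IsLabelWeightedSTPP A B C κ μ →
      IsLabelWeightedSTPP (fun i => (A i).image (fun (v : Fin D → ℤ) (t : Fin D) => (v t : ZMod m)))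
          (fun i => (B i).image (fun (v : Fin D → ℤ) (t : Fin D) => (v t : ZMod m)))
          (fun i => (C i).image (fun (v : Fin D → ℤ) (t : Fin D) => (v t : ZMod m))) κ μ ∧
      (∀ i, ((A i).image (fun (v : Fin D → ℤ) (t : Fin D) => (v t : ZMod m))).card = (A i).card ∧
        ((B i).image (fun (v : Fin D → ℤ) (t : Fin D) => (v t : ZMod m))).card = (B i).card ∧
        ((C i).image (fun (v : Fin D → ℤ) (t : Fin D) => (v t : ZMod m))).card = (C i).card) := by
  sorry

/-- **stub_gradedFrames** — multi-radius orthogonal frames are label-weighted (Pythagoras)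
(`= GradedFramesWeighted`). [M, provable now; BRIDGE to the sphere line] -/
theorem stub_gradedFrames :
    ∀ (D L : ℕ) (A B C : Fin L → Finset (Fin D → ℤ)) (d : Fin L → ℤ) (xA xB xC α β γ : ℤ),
      (0 ≤ α ∧ 0 ≤ γ ∧ 1 ≤ α + γ ∧ α < β ∧ γ < β) →
      ((∀ i, ∀ x ∈ A i, ∀ y ∈ B i, x ⬝ᵥ y = 0) ∧ (∀ i, ∀ x ∈ A i, ∀ z ∈ C i, x ⬝ᵥ z = 0) ∧
        (∀ i, ∀ y ∈ B i, ∀ z ∈ C i, y ⬝ᵥ z = 0)) →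
      ((∀ i, ∀ x ∈ A i, x ⬝ᵥ x = xA + α * d i) ∧ (∀ i, ∀ y ∈ B i, y ⬝ᵥ y = xB - β * d i) ∧
        (∀ i, ∀ z ∈ C i, z ⬝ᵥ z = xC + γ * d i)) →
      (IsLabelWeightedSTPP A B C (fun i => -d i) (fun i => -d i) ↔
        ((∀ i k, ∀ a ∈ A i, ∀ c ∈ C i, ∀ a' ∈ A k, ∀ c' ∈ C k, c - a = c' - a' → i = k ∧ a = a' ∧ c = c') ∧
         (∀ i k, ∀ a ∈ A i, ∀ b ∈ B i, ∀ a' ∈ A k, ∀ b' ∈ B k, b - a = b' - a' → i = k ∧ a = a' ∧ b = b') ∧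
         (∀ i k, ∀ b ∈ B i, ∀ c ∈ C i, ∀ b' ∈ B k, ∀ c' ∈ C k, b - c = b' - c' → i = k ∧ b = b' ∧ c = c') ∧
         (∀ i j k : Fin L, i ≠ j → j ≠ k → i ≠ k → 2 * d k ≤ d i + d j →
            ∀ s ∈ A k, ∀ s' ∈ A i, ∀ t ∈ B i, ∀ t' ∈ B j, ∀ u ∈ C j, ∀ u' ∈ C k,
              (s' - s) + (t' - t) + (u' - u) ≠ 0))) := by
  sorry

/-- **stub_multiRadiusFrames** — existence of two-leg-tight multi-radius frame designs in boxes
(`= MultiRadiusFrameDesigns`). [XL, OPEN — the hardest stub; the crux's difficulty localised; held by the lead] -/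
theorem stub_multiRadiusFrames :
    ∀ a : ℝ, 0 ≤ a → a < 1 → ∀ η : ℝ, 0 < η →
      ∃ (D L N M b R : ℕ) (A B C : Fin L → Finset (Fin D → ℤ)) (d : Fin L → ℤ) (xA xB xC α β γ : ℤ),
        (0 ≤ α ∧ 0 ≤ γ ∧ 1 ≤ α + γ ∧ α < β ∧ γ < β) ∧
        ((∀ i, ∀ x ∈ A i, ∀ y ∈ B i, x ⬝ᵥ y = 0) ∧ (∀ i, ∀ x ∈ A i, ∀ z ∈ C i, x ⬝ᵥ z = 0) ∧
          (∀ i, ∀ y ∈ B i, ∀ z ∈ C i, y ⬝ᵥ z = 0)) ∧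
        ((∀ i, ∀ x ∈ A i, x ⬝ᵥ x = xA + α * d i) ∧ (∀ i, ∀ y ∈ B i, y ⬝ᵥ y = xB - β * d i) ∧
          (∀ i, ∀ z ∈ C i, z ⬝ᵥ z = xC + γ * d i)) ∧
        ((∀ i k, ∀ a ∈ A i, ∀ c ∈ C i, ∀ a' ∈ A k, ∀ c' ∈ C k, c - a = c' - a' → i = k ∧ a = a' ∧ c = c') ∧
         (∀ i k, ∀ a ∈ A i, ∀ b ∈ B i, ∀ a' ∈ A k, ∀ b' ∈ B k, b - a = b' - a' → i = k ∧ a = a' ∧ b = b') ∧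
         (∀ i k, ∀ b ∈ B i, ∀ c ∈ C i, ∀ b' ∈ B k, ∀ c' ∈ C k, b - c = b' - c' → i = k ∧ b = b' ∧ c = c') ∧
         (∀ i j k : Fin L, i ≠ j → j ≠ k → i ≠ k → 2 * d k ≤ d i + d j →
            ∀ s ∈ A k, ∀ s' ∈ A i, ∀ t ∈ B i, ∀ t' ∈ B j, ∀ u ∈ C j, ∀ u' ∈ C k,
              (s' - s) + (t' - t) + (u' - u) ≠ 0)) ∧
        (∀ i, (A i).card = N ∧ (B i).card = M ∧ (C i).card = N) ∧ 2 ≤ N ∧ (N : ℝ) ^ a ≤ M ∧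
        (∀ i, (∀ v ∈ A i, ∀ t, |v t| ≤ (b : ℤ)) ∧ (∀ v ∈ B i, ∀ t, |v t| ≤ (b : ℤ)) ∧
          (∀ v ∈ C i, ∀ t, |v t| ≤ (b : ℤ))) ∧
        (∀ i, |d i| ≤ (R : ℤ)) ∧
        (((6 * b + 1 : ℕ) : ℝ)) ^ D ≤ L * (N : ℝ) ^ (2 + η) := by
  sorry

/-! The registered signatures ARE the named statements (definitional unfolding only). -/

example : DeborderingPower := stub_deborderingPower
example : BoxFreimanTransfer := stub_boxFreiman
example : GradedFramesWeighted := stub_gradedFrames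
example : MultiRadiusFrameDesigns := stub_multiRadiusFrames

/-! ## Composition (real proofs, no `sorry` below this line) -/

/-- Exponentials beat squares: for `r > 1` and any `K` some `n ≥ 1` has `K·n² ≤ rⁿ`. -/
theorem exists_sq_le_pow {r : ℝ} (hr : 1 < r) (K : ℝ) : ∃ n : ℕ, 1 ≤ n ∧ K * (n : ℝ) ^ 2 ≤ r ^ n := by
  by_cases hK : K ≤ 0
  · refine ⟨1, le_rfl, ?_⟩
    have : K * ((1 : ℕ) : ℝ) ^ 2 ≤ 0 := by
      simp only [Nat.cast_one, one_pow, mul_one]; exact hK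
    exact this.trans (by positivity)
  · have hK : 0 < K := lt_of_not_ge hK
    have hlim := tendsto_pow_const_div_const_pow_of_one_lt 2 hr
    have hε : (0 : ℝ) < 1 / K := by positivity
    obtain ⟨n, hn, hn1⟩ := ((hlim.eventually (gt_mem_nhds hε)).and (eventually_ge_atTop 1)).exists
    refine ⟨n, hn1, ?_⟩
    have hrn : (0 : ℝ) < r ^ n := pow_pos (by linarith) n
    have h1 : (n : ℝ) ^ 2 < 1 / K * r ^ n := (div_lt_iff₀ hrn).1 hn
    have h2 : K * (n : ℝ) ^ 2 < K * (1 / K * r ^ n) := mul_lt_mul_of_pos_left h1 hK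
    have h3 : K * (1 / K * r ^ n) = r ^ n := by field_simp
    linarith

/-- **`C⁺ → ThinPackings`** (the card's `Debordering`, from the finite core): take a weighted family at slack
`η/2`, tensor up `n` times with `(2nR+1)² ≤ N^{nη/2}`, keep the popular weight class. -/
theorem debordering (hP : DeborderingPower) : Debordering := by
  intro hW a ha0 ha1 η hη
  obtain ⟨H, hH1, hH2, L, N, M, R, A, B, C, κ, μ, hLW, hc, hN, hM, hR, hH⟩ :=
    hW a ha0 ha1 (η / 2) (by positivity)
  have hN1 : (1 : ℝ) < N := by exact_mod_cast (by omega : 1 < N)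
  have hNpos : (0 : ℝ) < N := by linarith
  have hN0 : (0 : ℝ) ≤ N := hNpos.le
  -- choose the tensor power
  set r : ℝ := (N : ℝ) ^ (η / 2) with hr
  have hr1 : 1 < r := Real.one_lt_rpow hN1 (by positivity)
  obtain ⟨n, hn1, hn⟩ := exists_sq_le_pow hr1 (((2 * R + 1 : ℕ) : ℝ) ^ 2)
  obtain ⟨L', A', B', C', hS, hc', hL'⟩ := hP H L N M R A B C κ μ hLW hc hR n
  refine ⟨Fin n → H, inferInstance, inferInstance, L', N ^ n, M ^ n, A', B', C', hS, hc', ?_, ?_, ?_⟩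
  · -- 2 ≤ N ^ n
    calc 2 ≤ N := hN
      _ = N ^ 1 := (pow_one N).symm
      _ ≤ N ^ n := Nat.pow_le_pow_right (by omega) hn1
  · -- (N^n)^a ≤ M^n
    have h0 : (0 : ℝ) ≤ (N : ℝ) ^ a := by positivity
    push_cast
    rw [← Real.rpow_natCast_mul hN0, mul_comm, Real.rpow_mul_natCast hN0]
    exact pow_le_pow_left₀ h0 hM n
  · -- the packing count
    have hcardH : (0 : ℝ) ≤ Fintype.card H := Nat.cast_nonneg _
    have hL'R : ((L : ℝ)) ^ n ≤ (L' : ℝ) * ((2 * n * R + 1 : ℕ) : ℝ) ^ 2 := by exact_mod_cast hL'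
    -- (2nR+1)^2 ≤ (2R+1)^2 n^2 ≤ r^n
    have hsq : (((2 * n * R + 1 : ℕ) : ℝ)) ^ 2 ≤ r ^ n := by
      have h1 : ((2 * n * R + 1 : ℕ) : ℝ) ≤ ((2 * R + 1 : ℕ) : ℝ) * n := by
        have : 2 * n * R + 1 ≤ (2 * R + 1) * n := by nlinarith
        exact_mod_cast this
      have h2 : (0 : ℝ) ≤ ((2 * n * R + 1 : ℕ) : ℝ) := Nat.cast_nonneg _
      calc (((2 * n * R + 1 : ℕ) : ℝ)) ^ 2 ≤ (((2 * R + 1 : ℕ) : ℝ) * n) ^ 2 :=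
            pow_le_pow_left₀ h2 h1 2
        _ = ((2 * R + 1 : ℕ) : ℝ) ^ 2 * (n : ℝ) ^ 2 := by ring
        _ ≤ r ^ n := hn
    have hL'0 : (0 : ℝ) ≤ L' := Nat.cast_nonneg _
    -- exponent identities
    have hsplit : r * (N : ℝ) ^ (2 + η / 2) = (N : ℝ) ^ (2 + η) := by
      rw [hr, ← Real.rpow_add hNpos]; ring_nf
    have hpow : ((N : ℝ) ^ (2 + η)) ^ n = (((N ^ n : ℕ) : ℝ)) ^ (2 + η) := by
      push_cast
      rw [← Real.rpow_mul_natCast hN0, mul_comm, Real.rpow_natCast_mul hN0]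
    rw [Fintype.card_fun, Fintype.card_fin]
    push_cast
    calc ((Fintype.card H : ℝ)) ^ n ≤ ((L : ℝ) * (N : ℝ) ^ (2 + η / 2)) ^ n :=
          pow_le_pow_left₀ hcardH hH n
      _ = (L : ℝ) ^ n * ((N : ℝ) ^ (2 + η / 2)) ^ n := mul_pow _ _ _
      _ ≤ ((L' : ℝ) * ((2 * n * R + 1 : ℕ) : ℝ) ^ 2) * ((N : ℝ) ^ (2 + η / 2)) ^ n := by
          gcongr
      _ ≤ ((L' : ℝ) * r ^ n) * ((N : ℝ) ^ (2 + η / 2)) ^ n := by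
          gcongr
      _ = (L' : ℝ) * ((r * (N : ℝ) ^ (2 + η / 2)) ^ n) := by rw [mul_pow]; ring
      _ = (L' : ℝ) * (((N : ℝ) ^ n)) ^ (2 + η) := by
          rw [hsplit, hpow]; push_cast; rfl

/-- **Frames feed `C⁺`**: a multi-radius frame design is label-weighted (`stub_gradedFrames`), survives reduction
modulo `6b+1` (`stub_boxFreiman`), and the host `(ℤ/(6b+1))^D` has the recorded size. -/
theorem weightedThinPackings_of_frames (hT : BoxFreimanTransfer) (hG : GradedFramesWeighted)
    (hF : MultiRadiusFrameDesigns) : WeightedThinPackings := by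
  intro a ha0 ha1 η hη
  obtain ⟨D, L, N, M, b, R, A, B, C, d, xA, xB, xC, α, β, γ, hsl, hfr, hsph, hres, hc, hN, hM, hbox, hR,
    hcount⟩ := hF a ha0 ha1 η hη
  have hLW : IsLabelWeightedSTPP A B C (fun i => -d i) (fun i => -d i) :=
    (hG D L A B C d xA xB xC α β γ hsl hfr hsph).2 hres
  obtain ⟨hLW', hc'⟩ := hT D L b (6 * b + 1) A B C (fun i => -d i) (fun i => -d i) (by omega) hbox hLW
  refine ⟨Fin D → ZMod (6 * b + 1), inferInstance, inferInstance, L, N, M, R,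
    fun i => (A i).image (boxCast D (6 * b + 1)), fun i => (B i).image (boxCast D (6 * b + 1)),
    fun i => (C i).image (boxCast D (6 * b + 1)), fun i => -d i, fun i => -d i, hLW', ?_, hN, hM, ?_, ?_⟩
  · intro i
    obtain ⟨h1, h2, h3⟩ := hc' i
    obtain ⟨g1, g2, g3⟩ := hc i
    exact ⟨h1.trans g1, h2.trans g2, h3.trans g3⟩
  · intro i
    have h := hR i
    simp only [abs_neg]
    exact ⟨h, h⟩
  · rw [Fintype.card_fun, Fintype.card_fin, ZMod.card]
    push_cast at hcount ⊢
    exact hcount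

/-- **Composition (the skeleton theorem).** The crux `ThinPackings`, concluded BY NAME, as a closed term over
the four registered stubs. -/
theorem ThinPackings_of : ThinPackings :=
  debordering stub_deborderingPower
    (weightedThinPackings_of_frames stub_boxFreiman stub_gradedFrames stub_multiRadiusFrames)

end Summit.MatrixMultiplication.MatrixMultiplication.Cruxes.ThinPackings.LabelWeightedStppDebordering
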